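import Literature.Analysis.FunctionSpaces.TorusFourierCalculus
import Literature.Analysis.FunctionSpaces.TorusRieszFischerParam
import Literature.Analysis.FunctionSpaces.TorusFourierModes
import Literature.Analysis.FunctionSpaces.TorusConvolution
import HarnessLib

/-!
# Fourier coefficients on `T^d`: uniqueness for continuous functions, convolution theorem, Laplacian

Analysis/FunctionSpaces support file (scalar, complex-valued functions on the flat torus
`T^d = UnitAddTorus d`, global `volume` convention of `FlatTorus`). Three items of Grafakos 2014,
§3.1–3.2, in the form consumed by Fourier-multiplier constructions such as the inverse Laplacian
of `TorusInverseLaplacian`: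

* `Torus.eq_of_forall_mFourierCoeff_eq` — **uniqueness**: continuous functions with the same
  Fourier coefficients are equal (Grafakos 2014, Prop. 3.2.4 gives a.e. equality for `L¹`
  functions; for continuous functions, via Plancherel for the difference,
  `Torus.hasSum_sq_mFourierCoeff_of_continuous`, and positivity of Haar measure on open sets, the
  equality is everywhere);
* `Torus.mFourierCoeff_convolution` — **convolution theorem** `𝓕(θ ⋆ w)(k) = 𝓕θ(k) 𝓕w(k)` for a
  continuous real kernel `θ` and continuous complex `w`, `(θ ⋆ w)(x) = ∫ θ(y) w(x-y) dy` being
  Mathlib's group convolution on `T^d` (Grafakos 2014, Prop. 3.1.2 (9), with the printed proof: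
  Fubini and translation invariance);
* `Torus.mFourierCoeff_laplacian_complex`, `Torus.mFourierCoeff_laplacian_iterate` —
  `𝓕(Δⁿw)(k) = (-4π²|k|²)ⁿ 𝓕w(k)` for smooth `w` (Grafakos 2014, Prop. 3.1.2 (10), from the accepted
  `Torus.mFourierCoeff_partialDeriv`);

plus bookkeeping: coefficients of real multiples and real constants, iterated Laplacians of smooth
functions are smooth, and complexification `h ↦ (h : ℂ)` commutes with `Δ`, `Δⁿ` and with
convolution by a real kernel (`Torus.ofReal_laplacian`, `Torus.ofReal_convolution`), `Δ(c • f) = c • Δf`.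

## Mathlib search

Mathlib (this pin) has `mFourierCoeff`, the Hilbert basis `mFourierBasis` and Parseval
`hasSum_sq_mFourierCoeff` for `L²` classes, but no convolution theorem for `mFourierCoeff` and no
uniqueness statement for functions (searched `mFourierCoeff_conv`, `mFourierCoeff_eq_zero`,
`eq_of_mFourierCoeff`: nothing outside `Literature/`).

## References

* L. Grafakos, *Classical Fourier Analysis*, 3rd ed., GTM 249 (Springer 2014), Prop. 3.1.2 (9),
  (10) (PDF p. 188), Prop. 3.2.4 (PDF p. 194), Prop. 3.2.7 (1) (PDF p. 195). [`Grafakos2014`]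
-/

noncomputable section

open MeasureTheory Set Filter Topology UnitAddTorus Function
open scoped Convolution ContDiff ComplexConjugate ENNReal

namespace Literature.Analysis.FunctionSpaces

namespace Torus

variable {d : Type*} [Fintype d]

/-! ## Fourier toolkit for scalar functions: uniqueness, convolution theorem, Laplacian -/

section Toolkit

/-- `conj(e_k) · f` is integrable for integrable `f`. [folklore] -/
theorem integrable_conj_mFourier_mul {f : UnitAddTorus d → ℂ} (hf : Integrable f volume)
    (k : d → ℤ) : Integrable (fun x => conj (mFourier k x) * f x) volume :=
  hf.bdd_mul ((mFourier k).continuous.star).aestronglyMeasurable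
    (Eventually.of_forall fun x => by rw [RCLike.norm_conj, norm_mFourier_apply])

/-- Fourier coefficients of a real multiple. [folklore] -/
theorem mFourierCoeff_real_smul (c : ℝ) (f : UnitAddTorus d → ℂ) (k : d → ℤ) :
    mFourierCoeff (fun x => c • f x) k = (c : ℂ) * mFourierCoeff f k := by
  simp only [mFourierCoeff_eq_integral_conj_mul, Complex.real_smul, ← integral_const_mul]
  refine integral_congr_ae (ae_of_all _ fun x => ?_)
  ring

/-- Fourier coefficients of a real constant: `𝓕(c)(k) = c δ_{k0}`. [folklore] -/
theorem mFourierCoeff_const_real (c : ℝ) (k : d → ℤ) :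
    mFourierCoeff (fun _ : UnitAddTorus d => (c : ℂ)) k = if k = 0 then (c : ℂ) else 0 := by
  classical
  rw [mFourierCoeff_eq_integral_conj_mul]
  have h : ∀ x : UnitAddTorus d, conj (mFourier k x) * (c : ℂ) =
      (c : ℂ) * (conj (mFourier k x) * mFourier 0 x) := fun x => by
    rw [mFourier_zero]
    simp [mul_comm]
  simp_rw [h, integral_const_mul, integral_conj_mFourier_mul_mFourier]
  by_cases hk : k = 0
  · simp [hk]
  · simp [hk]

/-- **Uniqueness of Fourier coefficients for continuous functions** (Grafakos 2014,
Prop. 3.2.4: `L¹` functions with the same Fourier coefficients agree a.e.; here for continuous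
functions, which then agree everywhere): proof by Plancherel for the difference (Prop. 3.2.7 (1),
`Torus.hasSum_sq_mFourierCoeff_of_continuous`), then continuity and positivity of Haar measure on
open sets. [cite: Grafakos2014, Prop. 3.2.4] -/
theorem eq_of_forall_mFourierCoeff_eq {f g : UnitAddTorus d → ℂ} (hf : Continuous f)
    (hg : Continuous g) (h : ∀ k, mFourierCoeff f k = mFourierCoeff g k) : f = g := by
  set u : UnitAddTorus d → ℂ := f - g with hu_def
  have hu : Continuous u := hf.sub hg
  have hcoef : ∀ k, mFourierCoeff u k = 0 := fun k => by
    rw [hu_def, mFourierCoeff_sub hf.integrable_unitAddTorus hg.integrable_unitAddTorus, h k,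
      sub_self]
  have hP := hasSum_sq_mFourierCoeff_of_continuous hu
  simp only [hcoef, norm_zero, ne_eq, OfNat.ofNat_ne_zero, not_false_eq_true, zero_pow] at hP
  have h0 : ∫ x, ‖u x‖ ^ 2 = 0 := hP.unique hasSum_zero
  have hae : (fun x => ‖u x‖ ^ 2) =ᵐ[volume] 0 :=
    (integral_eq_zero_iff_of_nonneg (fun x => sq_nonneg _)
      ((hu.norm.pow 2).integrable_unitAddTorus)).1 h0
  have heq : (fun x => ‖u x‖ ^ 2) = 0 :=
    (Continuous.ae_eq_iff_eq volume (hu.norm.pow 2) continuous_zero).1 hae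
  funext x
  have hx := congr_fun heq x
  simp only [Pi.zero_apply, ne_eq, OfNat.ofNat_ne_zero, not_false_eq_true, pow_eq_zero_iff,
    norm_eq_zero, hu_def, Pi.sub_apply] at hx
  exact sub_eq_zero.1 hx

/-- **Convolution theorem on `T^d`** (Grafakos 2014, Prop. 3.1.2 (9)): for a continuous real
kernel `θ` and a continuous complex function `w`, `𝓕(θ ⋆ w)(k) = 𝓕θ(k) 𝓕w(k)`, where
`(θ ⋆ w)(x) = ∫ θ(y) w(x - y) dy` (Fubini on `T^d × T^d` and translation invariance of Haar
measure, `e_k(x' + y) = e_k(x') e_k(y)`, exactly the printed proof). [cite: Grafakos2014, Prop. 3.1.2 (9)] -/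
theorem mFourierCoeff_convolution {θ : UnitAddTorus d → ℝ} (hθ : Continuous θ)
    {w : UnitAddTorus d → ℂ} (hw : Continuous w) (k : d → ℤ) :
    mFourierCoeff (θ ⋆ w) k = mFourierCoeff (fun x => (θ x : ℂ)) k * mFourierCoeff w k := by
  simp only [mFourierCoeff_eq_integral_conj_mul]
  -- the integrand on `T^d × T^d`
  set Φ : UnitAddTorus d → UnitAddTorus d → ℂ :=
    fun x y => conj (mFourier k x) * ((θ y : ℂ) * w (x - y)) with hΦ_def
  have hΦc : Continuous (uncurry Φ) := by
    simp only [hΦ_def]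
    fun_prop
  have hΦi : Integrable (uncurry Φ) ((volume : Measure (UnitAddTorus d)).prod volume) :=
    hΦc.integrable_of_hasCompactSupport (HasCompactSupport.of_compactSpace _)
  calc ∫ x, conj (mFourier k x) * (θ ⋆ w) x
      = ∫ x, ∫ y, Φ x y := by
        refine integral_congr_ae (ae_of_all _ fun x => ?_)
        simp only [hΦ_def, convolution_lsmul, Complex.real_smul, ← integral_const_mul]
    _ = ∫ y, ∫ x, Φ x y := integral_integral_swap hΦi
    _ = ∫ y, conj (mFourier k y) * (θ y : ℂ) * ∫ x, conj (mFourier k x) * w x := by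
        refine integral_congr_ae (ae_of_all _ fun y => ?_)
        beta_reduce
        have h1 : ∫ x, Φ x y = ∫ x, Φ (x + y) y := (integral_add_right_eq_self (fun x => Φ x y) y).symm
        rw [h1, ← integral_const_mul]
        refine integral_congr_ae (ae_of_all _ fun x => ?_)
        simp only [hΦ_def, add_sub_cancel_right, mFourier_apply_add, map_mul]
        ring
    _ = (∫ y, conj (mFourier k y) * (θ y : ℂ)) * ∫ x, conj (mFourier k x) * w x :=
        integral_mul_const _ _

/-- The Laplacian of a complex-valued smooth function has Fourier coefficients
`𝓕(Δw)(k) = -4π²|k|² 𝓕w(k)` (Grafakos 2014, Prop. 3.1.2 (10), `𝓕(∂^α f)(m) = (2πim)^α 𝓕f(m)`,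
applied with `|α| = 2` in each coordinate and summed). [cite: Grafakos2014, Prop. 3.1.2 (10)] -/
theorem mFourierCoeff_laplacian_complex {w : UnitAddTorus d → ℂ} (hw : IsSmooth w) (k : d → ℤ) :
    mFourierCoeff (laplacian w) k = -(4 * Real.pi ^ 2 * freqNormSq k : ℝ) * mFourierCoeff w k := by
  classical
  have h1 : laplacian w = fun x => ∑ i, partialDeriv i (partialDeriv i w) x :=
    funext (laplacian_eq_sum_partialDeriv_partialDeriv hw)
  rw [h1, mFourierCoeff_finset_sum _ fun i _ => ((hw.partialDeriv i).partialDeriv i).integrable]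
  simp_rw [mFourierCoeff_partialDeriv (hw.partialDeriv _), mFourierCoeff_partialDeriv hw, smul_smul,
    ← Finset.sum_smul, smul_eq_mul]
  congr 1
  have hI : ∀ i : d, (2 * ↑Real.pi * Complex.I * ↑(k i)) * (2 * ↑Real.pi * Complex.I * ↑(k i)) =
      -(4 * ↑Real.pi ^ 2 * ((k i : ℝ) : ℂ) ^ 2) := fun i => by
    have : Complex.I * Complex.I = -1 := Complex.I_mul_I
    push_cast
    linear_combination (4 * ↑Real.pi ^ 2 * ((k i : ℂ)) ^ 2) * this
  simp_rw [hI, Finset.sum_neg_distrib, ← Finset.mul_sum, freqNormSq]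
  push_cast
  ring

/-- Iterated Laplacians of smooth functions are smooth. [folklore] -/
theorem isSmooth_laplacian_iterate {F : Type*} [NormedAddCommGroup F] [NormedSpace ℝ F]
    {f : UnitAddTorus d → F} (hf : IsSmooth f) : ∀ n : ℕ, IsSmooth (laplacian^[n] f)
  | 0 => hf
  | n + 1 => by
    rw [iterate_succ_apply']
    exact (isSmooth_laplacian_iterate hf n).laplacian

/-- `𝓕(Δⁿ w)(k) = (-4π²|k|²)ⁿ 𝓕w(k)` for smooth complex `w`. [cite: Grafakos2014, Prop. 3.1.2 (10)] -/
theorem mFourierCoeff_laplacian_iterate {w : UnitAddTorus d → ℂ} (hw : IsSmooth w) (k : d → ℤ) :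
    ∀ n : ℕ, mFourierCoeff (laplacian^[n] w) k =
      (-(4 * Real.pi ^ 2 * freqNormSq k : ℝ) : ℂ) ^ n * mFourierCoeff w k
  | 0 => by simp
  | n + 1 => by
    rw [iterate_succ_apply', mFourierCoeff_laplacian_complex (isSmooth_laplacian_iterate hw n),
      mFourierCoeff_laplacian_iterate hw k n, pow_succ]
    ring

/-- Complexification commutes with the Laplacian: `(Δh : ℂ) = Δ(h : ℂ)` for smooth real `h`
(Mathlib's `ContDiffAt.laplacian_CLM_comp_left` with `Complex.ofRealCLM`). [folklore] -/
theorem ofReal_laplacian {h : UnitAddTorus d → ℝ} (hh : IsSmooth h) (x : UnitAddTorus d) :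
    ((laplacian h x : ℝ) : ℂ) = laplacian (fun y => (h y : ℂ)) x := by
  have h2 : ContDiffAt ℝ 2 (liftAt h x) 0 := ((hh.liftAt x).of_le (WithTop.coe_le_coe.mpr le_top)).contDiffAt
  have key := h2.laplacian_CLM_comp_left (l := Complex.ofRealCLM)
  have hl : liftAt (fun y => (h y : ℂ)) x = Complex.ofRealCLM ∘ liftAt h x := rfl
  simp only [Torus.laplacian, hl, key, comp_apply, Complex.ofRealCLM_apply]

/-- The complexification of a smooth real function is smooth. [folklore] -/
theorem IsSmooth.ofReal {h : UnitAddTorus d → ℝ} (hh : IsSmooth h) : IsSmooth (fun y => (h y : ℂ)) :=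
  hh.comp_clm Complex.ofRealCLM

/-- Complexification commutes with iterated Laplacians. [folklore] -/
theorem ofReal_laplacian_iterate {h : UnitAddTorus d → ℝ} (hh : IsSmooth h) :
    ∀ (n : ℕ) (x : UnitAddTorus d),
      ((laplacian^[n] h x : ℝ) : ℂ) = (laplacian^[n] fun y => (h y : ℂ)) x
  | 0, x => rfl
  | n + 1, x => by
    rw [iterate_succ_apply', iterate_succ_apply', ofReal_laplacian (isSmooth_laplacian_iterate hh n)]
    congr 1
    funext y
    exact ofReal_laplacian_iterate hh n y

/-- Complexification commutes with convolution by a real kernel: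
`((θ ⋆ g)(x) : ℂ) = (θ ⋆ (g : ℂ))(x)`. [folklore] -/
theorem ofReal_convolution (θ g : UnitAddTorus d → ℝ) (x : UnitAddTorus d) :
    (((θ ⋆ g) x : ℝ) : ℂ) = (θ ⋆ fun y => (g y : ℂ)) x := by
  simp only [convolution_lsmul, smul_eq_mul, Complex.real_smul]
  rw [← integral_complex_ofReal]
  simp_rw [Complex.ofReal_mul]

/-- The Laplacian of a constant multiple: `Δ(c • f) = c • Δf` for smooth `f`. [folklore] -/
theorem laplacian_const_smul_apply {F : Type*} [NormedAddCommGroup F] [NormedSpace ℝ F]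
    {f : UnitAddTorus d → F} (hf : IsSmooth f) (c : ℝ) (x : UnitAddTorus d) :
    laplacian (c • f) x = c • laplacian f x := by
  have h2 : ContDiffAt ℝ 2 (liftAt f x) 0 := ((hf.liftAt x).of_le (WithTop.coe_le_coe.mpr le_top)).contDiffAt
  have hl : liftAt (c • f) x = c • liftAt f x := rfl
  simp only [Torus.laplacian, hl]
  exact InnerProductSpace.laplacian_smul c h2

end Toolkit

end Torus

end Literature.Analysis.FunctionSpaces
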